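import Summits.BirchSwinnertonDyer.Rank1Residual.GaloisImage.TateModuleFrobeniusKolyvagin
import Summits.BirchSwinnertonDyer.BirchSwinnertonDyer.Theorems.Rank1ResidualJetBalancedInvolution
import Literature.NumberTheory.EllipticCurves.TateModuleProjSurjectiveProofs
import Literature.NumberTheory.EllipticCurves.SupersingularDensitySerreTraceProofs
import Literature.RepresentationTheory.FiniteGroups.InvariantLineOfFixedVectors
import HarnessLib

/-!
# T1 JET (cell `bsd-jet`), road K, input (L1) — brick B: the `ℚ`-Frobenius at a Kolyvagin prime of
# index `≥ k` is a BALANCED INVOLUTION on `E[p^k](ℚ̄)` (Gross (3.3) ⟹ (3.2)-shape at level `p^k`)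

HONEST FRAMING (programme file `BSD-LIT2PART-PROGRAMME-v1.md` §HONESTY, verbatim): «no tranche here
proves BSD; ARM L moves the LITERAL column of an r ≤ 1 census into the kernel-proved-modulo-named-print
column; ARM P changes what «named print» is worth.» THEOREMS ONLY (seat `bsd-jet-pv-1`, session g6;
`--supports stmt-BirchSwinnertonDyer-14418`, helper): no definition, no named fact, no `sorry`.
Nothing is booked; 0 classes move.

## What

For `E = W/ℚ` in global minimal form, an odd prime `p`, `k ≥ 1`, and a place `v = (ℓ)` of `ℚ` of
good reduction with `ℓ ≠ p`, `p^k ∣ ℓ + 1`, `p^k ∣ a_ℓ` (i.e. `k ≤ M(ℓ)`, Zhang's Kolyvagin index;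
Gross 1991 (3.3) for `k = 1`), and an arithmetic Frobenius `Fr ∈ Γ_ℚ` at a prime of `\bar ℤ` above
`v`:
* `frob_smul_frob_smul_eq_self_of_dvd` — **`Fr² = 1` on `E[p^k](ℚ̄)`**: Cayley–Hamilton on `T_p E`
  (`F(Ft) = a_ℓ • Ft − ℓ • t`, n1011's `galoisRepTate_apply_apply_eq_of_hasGoodReductionAt`,
  Silverman V.2.3.1 / C.21.3) pushed to `E[p^k]` along the SURJECTIVE projection `T_p E → E[p^k]`
  (`proj_surjective_of_isAlgClosed_holds`): `a_ℓ ≡ 0`, `−ℓ ≡ 1 (mod p^k)`;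
* `exists_frob_smul_ne_smul` — **`Fr ≠ ±1` on `E[p](ℚ̄)`**: `tr(Fr | E[p]) = a_ℓ ≡ 0 ≢ ±2 (mod p)`
  (the tree's `trace_galoisRepTorsion_frobenius_eq`, Serre 1981 (238));
* `natCard_le_of_ne_top_of_natCard_eq_sq` — a proper subgroup of a group of order `p²` has at most
  `p` elements;
* **`natCard_ker_frob_sub_smul_id_eq_pow`** — `#ker(Fr − s | E[p^k](ℚ̄)) = p^k` for `s = ±1`
  (brick A `natCard_ker_sub_smul_id_eq_pow`: `#E[p^k] = p^{2k}`, both eigenspaces cyclic).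

This is the `ℚ`-side of Jetchev 2008 §3.2 (2) / Gross (3.4) at level `p^k`: on `E[p^k]`, `Frob_ℓ`
looks like complex conjugation. Consumers: the decomposition group at `λ = (ℓ) ⊂ 𝓞_K` fixes
`E[p^k](K̄)` (brick C) and the adapted lift of `τ` is balanced on `E[p^k] ≅ H¹_ur(K_λ, E[p^k])`.

References (locators only; no cited FACT is declared): [cite: GrossLMS1991, §3 (3.2)–(3.4)]
[cite: Jetchev2008, §3.2 (2) (p. 815)] [cite: SilvermanAEC2009, Thm. V.2.3.1, C.21 Remark 21.3]
[cite: Serre1981, §8.1 eq. (238)]. Design: no definitions. Axioms: `propext`, `Classical.choice`,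
`Quot.sound`.
-/

set_option autoImplicit false

noncomputable section

open scoped Classical NumberField
open Function Field IsDedekindDomain WeierstrassCurve Rat.HeightOneSpectrum
open Literature.NumberTheory.EllipticCurves Literature.NumberTheory.GaloisRepresentations

namespace Summit.BirchSwinnertonDyer.Rank1Residual.JET.GlobalDuality

section KolyvaginFrobeniusRat

variable (W : WeierstrassCurve ℚ) [W.IsElliptic] [W.IsGloballyMinimal] (p : ℕ) [Fact p.Prime]

/-- **`Fr² = 1` on `E[p^k](ℚ̄)` at a Kolyvagin prime of index `≥ k`.** For a good place `v = (ℓ)`,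
`ℓ ≠ p`, with `p^k ∣ ℓ + 1` and `p^k ∣ a_ℓ`, and an arithmetic Frobenius `Fr` at a prime above `v`:
`Fr (Fr P) = P` for every `P ∈ E[p^k](ℚ̄)`. Cayley–Hamilton on `T_p E` (`F(Ft) = a_ℓ Ft − ℓ t`)
projected onto `E[p^k]` (the projection is onto). [cite: GrossLMS1991, §3 (3.3)]
[cite: SilvermanAEC2009, Thm. V.2.3.1, C.21 Remark 21.3] -/
theorem frob_smul_frob_smul_eq_self_of_dvd {k : ℕ} {v : HeightOneSpectrum (𝓞 ℚ)}
    (hne : ((primesEquiv v : Nat.Primes) : ℕ) ≠ p) (hv : W.HasGoodReductionAt v)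
    (h1 : p ^ k ∣ ((primesEquiv v : Nat.Primes) : ℕ) + 1)
    (ha : ((p ^ k : ℕ) : ℤ) ∣ W.frobeniusTrace (primesEquiv v))
    {Fr : absoluteGaloisGroup ℚ} (hFr : IsArithFrobAtPlace ℚ v Fr)
    (P : geomTorsion W ((p ^ k : ℕ) : ℤ)) : Fr • Fr • P = P := by
  set q : ℕ := ((primesEquiv v : Nat.Primes) : ℕ) with hq
  obtain ⟨t, ht⟩ := W.proj_surjective_of_isAlgClosed_holds p k P.2
  have hCH := GaloisImage.CyclotomicLevel.Rat.galoisRepTate_apply_apply_eq_of_hasGoodReductionAt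
    W p hne hv hFr t
  set X : geomPoints W := TateModule.proj p k t with hX
  apply Subtype.ext
  rw [AddSubgroup.torsionBy.coe_smul, AddSubgroup.torsionBy.coe_smul, ← ht, hX,
    ← TateModule.proj_smul_of_distribMulAction, ← TateModule.proj_smul_of_distribMulAction,
    ← galoisRepTate_apply_apply, ← galoisRepTate_apply_apply, hCH, map_sub, map_zsmul, map_zsmul,
    galoisRepTate_apply_apply, TateModule.proj_smul_of_distribMulAction, ← hX]
  -- `X := proj t` is `p^k`-torsion, so `a_ℓ • Fr X = 0` and `ℓ • X = -X`
  have hXt : ((p ^ k : ℕ) : ℤ) • X = 0 := by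
    rw [ht]; exact (mem_geomTorsion_iff W _ _).mp P.2
  obtain ⟨c, hc⟩ := ha
  obtain ⟨d, hd⟩ := h1
  have hA : W.frobeniusTrace (primesEquiv v) • Fr • X = 0 := by
    rw [hc, mul_comm, mul_smul, smul_comm (((p ^ k : ℕ) : ℤ)) Fr X, hXt, smul_zero, smul_zero]
  have hB : (q : ℤ) • X = -X := by
    have hq1 : (q : ℤ) = ((q + 1 : ℕ) : ℤ) - 1 := by push_cast; ring
    rw [hq1, sub_smul, one_smul, hd, Nat.cast_mul, mul_comm, mul_smul, hXt, smul_zero, zero_sub]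
  rw [hA, hB, zero_sub, neg_neg]

/-- **`Fr ≠ ±1` on `E[p](ℚ̄)`** at a good place `v = (ℓ)`, `ℓ ≠ p`, `p` odd, `p ∣ a_ℓ`: the trace of
`Fr` on the `𝔽_p`-plane `E[p]` is `a_ℓ ≡ 0`, whereas `tr(±1) = ±2 ≢ 0 (mod p)`.
[cite: Serre1981, §8.1 eq. (238)] [cite: GrossLMS1991, §3 (3.2)–(3.3)] -/
theorem exists_frob_smul_ne_smul (hp2 : p ≠ 2) {v : HeightOneSpectrum (𝓞 ℚ)}
    (hne : ((primesEquiv v : Nat.Primes) : ℕ) ≠ p) (hv : W.HasGoodReductionAt v)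
    (ha : (p : ℤ) ∣ W.frobeniusTrace (primesEquiv v))
    {Fr : absoluteGaloisGroup ℚ} (hFr : IsArithFrobAtPlace ℚ v Fr) {s : ℤ} (hs : s = 1 ∨ s = -1) :
    ∃ P : geomTorsion W (p : ℤ), Fr • P ≠ s • P := by
  have hp : p.Prime := Fact.out
  set q : ℕ := ((primesEquiv v : Nat.Primes) : ℕ) with hq
  haveI : Fact q.Prime := ⟨(primesEquiv v).2⟩
  have hgood : W.HasGoodReductionAtPrime q := (hasGoodReductionAtPrime_primesEquiv_iff_holds W v q rfl).mpr hv
  obtain ⟨𝔓, h𝔓, hσ⟩ := hFr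
  haveI : Finite (geomTorsion W (p : ℤ)) :=
    finite_torsionPoints_holds W (AlgebraicClosure ℚ) (by exact_mod_cast hp.ne_zero)
  letI : Module (ZMod p) (geomTorsion W (p : ℤ)) := AddSubgroup.torsionBy.zmodModule
  haveI : Module.Finite (ZMod p) (geomTorsion W (p : ℤ)) := Module.Finite.of_finite
  set f := (galoisRepTorsion W p Fr).toAdd.toAddMonoidHom.toZModLinearMap p with hfdef
  have hf : ∀ Q : geomTorsion W (p : ℤ), f Q = Fr • Q := fun Q => rfl
  have htr : LinearMap.trace (ZMod p) _ f = (W.frobeniusTrace q : ZMod p) :=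
    W.trace_galoisRepTorsion_frobenius_eq p hne hgood rfl h𝔓 hσ
  have h2 : Module.finrank (ZMod p) (geomTorsion W (p : ℤ)) = 2 :=
    Literature.RepresentationTheory.FiniteGroups.Representation.finrank_eq_two_of_natCard_eq_sq
      (card_torsionPoints_eq_sq_holds W (AlgebraicClosure ℚ) (n := p) (by exact_mod_cast hp.ne_zero))
  by_contra hall
  have hall' : ∀ Q : geomTorsion W (p : ℤ), Fr • Q = s • Q := fun Q => by
    by_contra hQ
    exact hall ⟨Q, hQ⟩
  -- `f = s • id`, so `tr f = 2s`
  have hfs : f = s • LinearMap.id := by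
    refine LinearMap.ext fun Q => ?_
    rw [hf, hall' Q, LinearMap.smul_apply, LinearMap.id_apply]
  have ha0 : (W.frobeniusTrace q : ZMod p) = 0 := by
    rw [ZMod.intCast_zmod_eq_zero_iff_dvd]; exact ha
  rw [hfs, map_zsmul, LinearMap.trace_id, h2, ha0] at htr
  have h20 : (2 : ZMod p) = 0 := by
    rcases hs with rfl | rfl
    · rwa [one_zsmul, Nat.cast_ofNat] at htr
    · rw [neg_one_zsmul, Nat.cast_ofNat, neg_eq_zero] at htr; exact htr
  have hdvd : p ∣ 2 := (ZMod.natCast_eq_zero_iff 2 p).mp (by exact_mod_cast h20)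
  exact hp2 ((Nat.prime_dvd_prime_iff_eq hp Nat.prime_two).mp hdvd)

omit [Fact p.Prime] in
/-- A proper subgroup of a finite abelian group of order `p²` (`p` prime) has at most `p`
elements (Lagrange). [folklore] -/
theorem natCard_le_of_ne_top_of_natCard_eq_sq {A : Type*} [AddCommGroup A] (hp : p.Prime)
    (hA : Nat.card A = p ^ 2) (H : AddSubgroup A) (hH : H ≠ ⊤) : Nat.card H ≤ p := by
  haveI : Finite A := Nat.finite_of_card_ne_zero (by rw [hA]; exact pow_ne_zero 2 hp.ne_zero)
  have hdvd : Nat.card H ∣ p ^ 2 := hA ▸ H.card_addSubgroup_dvd_card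
  obtain ⟨i, hi, hcard⟩ := (Nat.dvd_prime_pow hp).mp hdvd
  have hi2 : i ≠ 2 := by
    rintro rfl
    exact hH (AddSubgroup.eq_top_of_card_eq H (by rw [hcard, hA]))
  rw [hcard]
  calc p ^ i ≤ p ^ 1 := Nat.pow_le_pow_right hp.pos (by omega)
    _ = p := pow_one p

/-- **The `ℚ`-Frobenius at a Kolyvagin prime of index `≥ k` is a balanced involution on
`E[p^k](ℚ̄)`:** for `p` odd, `k ≥ 1`, `v = (ℓ)` good with `ℓ ≠ p`, `p^k ∣ ℓ + 1`, `p^k ∣ a_ℓ`, an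
arithmetic Frobenius `Fr` above `v` and `s = ±1`, the `s`-eigenspace `ker(Fr − s)` of `Fr` on
`E[p^k](ℚ̄)` has exactly `p^k` elements — `E[p^k]^± ≅ ℤ/p^k` (Jetchev 2008 §3.2 (2), Gross (3.4)).
Brick A with `Fr² = 1` (`frob_smul_frob_smul_eq_self_of_dvd`), `#E[p^k] = p^{2k}`
(`card_torsionPoints_eq_sq_holds`) and `Fr ≠ ±1` on `E[p]` (`exists_frob_smul_ne_smul`).
[cite: Jetchev2008, §3.2 (2) (p. 815)] [cite: GrossLMS1991, §3 (3.2)–(3.4)] -/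
theorem natCard_ker_frob_sub_smul_id_eq_pow (hp2 : p ≠ 2) {k : ℕ} (hk : 1 ≤ k)
    {v : HeightOneSpectrum (𝓞 ℚ)} (hne : ((primesEquiv v : Nat.Primes) : ℕ) ≠ p)
    (hv : W.HasGoodReductionAt v) (h1 : p ^ k ∣ ((primesEquiv v : Nat.Primes) : ℕ) + 1)
    (ha : ((p ^ k : ℕ) : ℤ) ∣ W.frobeniusTrace (primesEquiv v))
    {Fr : absoluteGaloisGroup ℚ} (hFr : IsArithFrobAtPlace ℚ v Fr) {s : ℤ} (hs : s = 1 ∨ s = -1) :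
    Nat.card (DistribSMul.toAddMonoidHom (geomTorsion W ((p ^ k : ℕ) : ℤ)) Fr -
        s • AddMonoidHom.id _).ker = p ^ k := by
  have hp : p.Prime := Fact.out
  set M := geomTorsion W ((p ^ k : ℕ) : ℤ) with hM
  set T : M →+ M := DistribSMul.toAddMonoidHom M Fr with hT
  have hTapply : ∀ x : M, T x = Fr • x := fun _ => rfl
  haveI : Finite M := finite_torsionPoints_holds W (AlgebraicClosure ℚ)
    (by exact_mod_cast pow_ne_zero k hp.ne_zero)
  have hcard : Nat.card M = p ^ (2 * k) := by
    rw [hM, mul_comm, pow_mul]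
    exact card_torsionPoints_eq_sq_holds W (AlgebraicClosure ℚ) (n := p ^ k)
      (by exact_mod_cast pow_ne_zero k hp.ne_zero)
  have hexp : ∀ x : M, p ^ k • x = 0 := fun x => Subtype.ext (by
    rw [AddSubgroup.coe_nsmul, AddSubgroup.coe_zero, ← natCast_zsmul]
    exact (mem_geomTorsion_iff W _ _).mp x.2)
  have hinv : ∀ x : M, T (T x) = x := fun x => by
    rw [hTapply, hTapply]; exact frob_smul_frob_smul_eq_self_of_dvd W p hne hv h1 ha hFr x
  -- `p ∣ a_ℓ`
  have ha1 : (p : ℤ) ∣ W.frobeniusTrace (primesEquiv v) :=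
    (dvd_trans (by exact_mod_cast dvd_pow_self p (by omega : k ≠ 0)) ha)
  refine natCard_ker_sub_smul_id_eq_pow hp hp2 hcard hexp T hinv (fun s' hs' => ?_) hs
  -- the `s'`-eigenvectors of `E[p^k]` killed by `p` inject into the PROPER eigen-subgroup of `E[p]`
  set H : AddSubgroup (geomTorsion W (p : ℤ)) :=
    (DistribSMul.toAddMonoidHom (geomTorsion W (p : ℤ)) Fr - s' • AddMonoidHom.id _).ker with hH
  have hHmem : ∀ {Q : geomTorsion W (p : ℤ)}, Q ∈ H ↔ Fr • Q = s' • Q := fun {Q} => by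
    rw [hH, AddMonoidHom.mem_ker, AddMonoidHom.sub_apply, AddMonoidHom.smul_apply,
      AddMonoidHom.id_apply, sub_eq_zero]
    rfl
  have hHtop : H ≠ ⊤ := by
    obtain ⟨Q, hQ⟩ := exists_frob_smul_ne_smul W p hp2 hne hv ha1 hFr hs'
    intro htop
    exact hQ (hHmem.mp (htop ▸ AddSubgroup.mem_top Q))
  have hHcard : Nat.card H ≤ p :=
    natCard_le_of_ne_top_of_natCard_eq_sq p hp
      (card_torsionPoints_eq_sq_holds W (AlgebraicClosure ℚ) (n := p) (by exact_mod_cast hp.ne_zero)) H hHtop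
  haveI : Finite (geomTorsion W (p : ℤ)) :=
    finite_torsionPoints_holds W (AlgebraicClosure ℚ) (by exact_mod_cast hp.ne_zero)
  -- the map `x ↦ x` into `E[p]`
  have hmem1 : ∀ x : ↥((T - s' • AddMonoidHom.id M).ker ⊓ AddSubgroup.torsionBy M (p : ℤ)),
      ((x : M) : geomPoints W) ∈ geomTorsion W (p : ℤ) := fun x => by
    rw [mem_geomTorsion_iff]
    have hx : (p : ℤ) • (x : M) = 0 := mem_torsionBy_iff_zsmul_eq_zero.mp x.2.2
    rw [← AddSubgroup.coe_zsmul, hx, AddSubgroup.coe_zero]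
  have hmem2 : ∀ x : ↥((T - s' • AddMonoidHom.id M).ker ⊓ AddSubgroup.torsionBy M (p : ℤ)),
      (⟨((x : M) : geomPoints W), hmem1 x⟩ : geomTorsion W (p : ℤ)) ∈ H := fun x => by
    rw [hHmem]
    apply Subtype.ext
    have hx : Fr • (x : M) = s' • (x : M) := by
      have h : (x : M) ∈ (T - s' • AddMonoidHom.id M).ker := (AddSubgroup.mem_inf.mp x.2).1
      rw [AddMonoidHom.mem_ker, AddMonoidHom.sub_apply, AddMonoidHom.smul_apply,
        AddMonoidHom.id_apply, sub_eq_zero, hTapply] at h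
      exact h
    change ((Fr • (x : M) : M) : geomPoints W) = ((s' • (x : M) : M) : geomPoints W)
    exact congrArg Subtype.val hx
  refine le_trans (Nat.card_le_card_of_injective
    (fun x => (⟨⟨((x : M) : geomPoints W), hmem1 x⟩, hmem2 x⟩ : H)) fun x y hxy => ?_) hHcard
  have h := congrArg (fun z : H => ((z : geomTorsion W (p : ℤ)) : geomPoints W)) hxy
  exact Subtype.ext (Subtype.ext h)

end KolyvaginFrobeniusRat

end Summit.BirchSwinnertonDyer.Rank1Residual.JET.GlobalDuality

end
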